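import Mathlib
import Literature.Geometry.DiscreteGeometry.KissingPatterns
import Summits.AtomisticToContinuum.Crystallization.Theorems.DisclinationRationFiveFoldRationStubPoleLemmaAux
import Summits.AtomisticToContinuum.Crystallization.Theorems.DisclinationRationFiveFoldRationStubShellMutualAux

/-!
# Crux `DisclinationRation.FiveFoldRation` (stmt-AtomisticToContinuum-15799), line `Sketch` —
# helpers for stub `stub_dr5_capping` (octahedron completion), part 1: the spectrum gap

The three patterns of the alphabet — the cuboctahedron `fccKissingPattern`, the anticuboctahedron
`hcpKissingPattern` and the decahedral pattern
`Deca = {±e₃} ∪ {(√3/2·cos(2πk/5), √3/2·sin(2πk/5), ±1/2)}` — have NO pair distance in the open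
interval `(26/25, 7/5)` (the hypothesis `hgap` of the link lemma `dr5lk_core`).  For the two
scaled integer patterns this is integer arithmetic (`dist² = sqNormInt/N`, checked by `decide`);
for `Deca` the pair distances are `1`, `√(3/2·(1 - cos 72°)) ≈ 1.018 ≤ 26/25` and otherwise
`≥ 7/5` (using `3/10 ≤ cos 72° ≤ 9/25` and `cos 144° ≤ -4/5`).  Helper prefix `dr5ca_`; the
decahedral trigonometry and distances are those of `…StubPoleLemmaAux` (`dr5pl_`) and
`…StubShellMutualAux` (`dr5sm_`).  Terms are written out (no local notations).
-/

noncomputable section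

namespace Summit.AtomisticToContinuum.Crystallization.Theorems

open Literature.Geometry.DiscreteGeometry

/-! ### Scaled integer patterns -/

/-- Generic spectrum gap for a scaled integer pattern `{v/√N}`: if every difference `v - w` has
squared norm `≤ N` or `≥ 49 N / 25`, then no pair distance lies in `(26/25, 7/5)` (in fact none
lies in `(1, 7/5)`). -/
theorem dr5ca_scaled_gap {P : Finset (Fin 3 → ℤ)} {N : ℕ} (hN : N ≠ 0)
    (h : ∀ v ∈ P, ∀ w ∈ P, sqNormInt (v - w) ≤ (N : ℤ) ∨ 49 * (N : ℤ) ≤ 25 * sqNormInt (v - w))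
    (p : EuclideanSpace ℝ (Fin 3)) (hp : p ∈ scaledPattern P N) (q : EuclideanSpace ℝ (Fin 3))
    (hq : q ∈ scaledPattern P N) : dist p q ≤ 26 / 25 ∨ 7 / 5 ≤ dist p q := by
  obtain ⟨v, hv, rfl⟩ := Finset.mem_image.1 hp
  obtain ⟨w, hw, rfl⟩ := Finset.mem_image.1 hq
  have hpos : (0 : ℝ) < Real.sqrt N := Real.sqrt_pos.2 (by exact_mod_cast Nat.pos_of_ne_zero hN)
  have hd : dist ((Real.sqrt N)⁻¹ • intVec v) ((Real.sqrt N)⁻¹ • intVec w) =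
      (Real.sqrt N)⁻¹ * Real.sqrt (sqNormInt (v - w) : ℝ) := by
    rw [dist_eq_norm, ← smul_sub, intVec_sub, norm_smul, norm_inv, Real.norm_of_nonneg hpos.le,
      norm_intVec]
  rw [hd]
  rcases h v hv w hw with h1 | h1
  · left
    rw [inv_mul_le_iff₀ hpos]
    have h2 : Real.sqrt (sqNormInt (v - w) : ℝ) ≤ Real.sqrt N :=
      Real.sqrt_le_sqrt (by exact_mod_cast h1)
    linarith [hpos.le]
  · right
    rw [le_inv_mul_iff₀ hpos]
    apply Real.le_sqrt_of_sq_le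
    rw [mul_pow, Real.sq_sqrt (Nat.cast_nonneg N)]
    have h2 : (49 * (N : ℝ)) ≤ 25 * (sqNormInt (v - w) : ℝ) := by exact_mod_cast h1
    linarith

/-- In the cuboctahedron integer model every difference has squared norm `≤ 2` or `≥ 4`. -/
theorem dr5ca_fccInt_gap : ∀ v ∈ fccInt, ∀ w ∈ fccInt,
    sqNormInt (v - w) ≤ ((2 : ℕ) : ℤ) ∨ 49 * ((2 : ℕ) : ℤ) ≤ 25 * sqNormInt (v - w) := by
  decide

/-- In the anticuboctahedron integer model every difference has squared norm `≤ 18` or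
`≥ 36`. -/
theorem dr5ca_hcpInt_gap : ∀ v ∈ hcpInt, ∀ w ∈ hcpInt,
    sqNormInt (v - w) ≤ ((18 : ℕ) : ℤ) ∨ 49 * ((18 : ℕ) : ℤ) ≤ 25 * sqNormInt (v - w) := by
  decide

/-- **Spectrum gap of the fcc pattern**: no pair distance in `(26/25, 7/5)` (the distances are
`0, 1, √2, √3, 2`). -/
theorem dr5ca_fcc_gap : ∀ p ∈ fccKissingPattern, ∀ q ∈ fccKissingPattern,
    dist p q ≤ 26 / 25 ∨ 7 / 5 ≤ dist p q := fun p hp q hq =>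
  dr5ca_scaled_gap two_ne_zero dr5ca_fccInt_gap p hp q hq

/-- **Spectrum gap of the hcp pattern**: no pair distance in `(26/25, 7/5)` (the distances are
`0, 1, √2, √(8/3), √3, √(11/3), 2`). -/
theorem dr5ca_hcp_gap : ∀ p ∈ hcpKissingPattern, ∀ q ∈ hcpKissingPattern,
    dist p q ≤ 26 / 25 ∨ 7 / 5 ≤ dist p q := fun p hp q hq =>
  dr5ca_scaled_gap (N := 18) (by norm_num) dr5ca_hcpInt_gap p hp q hq

/-! ### The decahedral pattern -/

/-- `cos 72° ≥ 3/10` (true value `(√5 - 1)/4 ≈ 0.309`), for the two labels `k = 1, 4` of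
`Fin 5` with `cos(2πk/5) = cos 72°`. -/
theorem dr5ca_cos_ge (k : Fin 5) (hk : k = 1 ∨ k = 4) :
    3 / 10 ≤ Real.cos (2 * Real.pi * (k : ℝ) / 5) := by
  have hpos : 0 < Real.cos (2 * Real.pi * (k : ℝ) / 5) := by
    rcases hk with rfl | rfl
    · have h1 : 2 * Real.pi * ((1 : Fin 5) : ℝ) / 5 = 2 * Real.pi / 5 := by norm_num
      rw [h1]
      exact Real.cos_pos_of_mem_Ioo ⟨by linarith [Real.pi_pos], by linarith [Real.pi_pos]⟩
    · have h1 : 2 * Real.pi * ((4 : Fin 5) : ℝ) / 5 = 2 * Real.pi - 2 * Real.pi / 5 := by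
        simp only [Fin.coe_ofNat_eq_mod, Nat.reduceMod, Nat.cast_ofNat]
        ring
      rw [h1, Real.cos_two_pi_sub]
      exact Real.cos_pos_of_mem_Ioo ⟨by linarith [Real.pi_pos], by linarith [Real.pi_pos]⟩
  rcases dr5pl_cos_root (k : ℕ) with h | h
  · rw [h]; norm_num
  · nlinarith

/-- Squares decide the gap: `a² ≤ (26/25)² ∨ 49/25 ≤ a²` gives `a ≤ 26/25 ∨ 7/5 ≤ a` for
`a ≥ 0`. -/
theorem dr5ca_gap_of_sq {a : ℝ} (ha : 0 ≤ a) (h : a ^ 2 ≤ 676 / 625 ∨ 49 / 25 ≤ a ^ 2) :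
    a ≤ 26 / 25 ∨ 7 / 5 ≤ a := by
  rcases h with h | h
  · left
    exact le_of_pow_le_pow_left₀ two_ne_zero (by norm_num) (by norm_num; exact h)
  · right
    exact le_of_pow_le_pow_left₀ two_ne_zero ha (by norm_num; exact h)

/-- Squared ring–ring distances of `Deca` avoid `((26/25)², 49/25)`. -/
theorem dr5ca_ring_gap_sq (j k : Fin 5) (σ τ : ℝ) (hσ : σ = 1 / 2 ∨ σ = -(1 / 2))
    (hτ : τ = 1 / 2 ∨ τ = -(1 / 2)) :
    3 / 2 * (1 - Real.cos (2 * Real.pi * ((j - k : Fin 5) : ℝ) / 5)) + (σ - τ) ^ 2 ≤ 676 / 625 ∨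
      49 / 25 ≤ 3 / 2 * (1 - Real.cos (2 * Real.pi * ((j - k : Fin 5) : ℝ) / 5)) + (σ - τ) ^ 2 := by
  have hστ : (σ - τ) ^ 2 = 0 ∨ (σ - τ) ^ 2 = 1 := by
    rcases hσ with rfl | rfl <;> rcases hτ with rfl | rfl <;> norm_num
  rcases dr5pl_fin5_cover k j with rfl | rfl | rfl | rfl | rfl
  · rw [sub_self]
    left
    have h0 : Real.cos (2 * Real.pi * ((0 : Fin 5) : ℝ) / 5) = 1 := by simp
    rw [h0]
    rcases hστ with h | h <;> rw [h] <;> norm_num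
  · rw [add_sub_cancel_left]
    have hlo := dr5ca_cos_ge 1 (Or.inl rfl)
    have hhi := dr5pl_cos_le_of_ne_zero 1 (by decide)
    rcases hστ with h | h <;> rw [h]
    · left; linarith
    · right; linarith
  · rw [sub_sub_cancel_left]
    have hlo := dr5ca_cos_ge (-1) (Or.inr (by decide))
    have hhi := dr5pl_cos_le_of_ne_zero (-1) (by decide)
    rcases hστ with h | h <;> rw [h]
    · left; linarith
    · right; linarith
  · rw [add_sub_cancel_left]
    have hc := dr5pl_cos_le_of_two_three 2 (by decide)
    right
    nlinarith [sq_nonneg (σ - τ)]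
  · rw [sub_sub_cancel_left]
    have hc := dr5pl_cos_le_of_two_three (-2) (by decide)
    right
    nlinarith [sq_nonneg (σ - τ)]

/-- **Spectrum gap of the decahedral pattern**: no pair distance in `(26/25, 7/5)` (the
distances are `0`, `1`, `≈ 1.018`, and otherwise `≥ 7/5`). -/
theorem dr5ca_deca_gap (x : EuclideanSpace ℝ (Fin 3))
    (hx : x ∈ {p : EuclideanSpace ℝ (Fin 3) | p = !₂[(0 : ℝ), 0, 1] ∨ p = !₂[(0 : ℝ), 0, -1] ∨
      ∃ k : Fin 5, ∃ σ : ℝ, (σ = 1 / 2 ∨ σ = -(1 / 2)) ∧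
        p = !₂[Real.sqrt 3 / 2 * Real.cos (2 * Real.pi * (k : ℝ) / 5),
          Real.sqrt 3 / 2 * Real.sin (2 * Real.pi * (k : ℝ) / 5), σ]})
    (x' : EuclideanSpace ℝ (Fin 3))
    (hx' : x' ∈ {p : EuclideanSpace ℝ (Fin 3) | p = !₂[(0 : ℝ), 0, 1] ∨ p = !₂[(0 : ℝ), 0, -1] ∨
      ∃ k : Fin 5, ∃ σ : ℝ, (σ = 1 / 2 ∨ σ = -(1 / 2)) ∧
        p = !₂[Real.sqrt 3 / 2 * Real.cos (2 * Real.pi * (k : ℝ) / 5),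
          Real.sqrt 3 / 2 * Real.sin (2 * Real.pi * (k : ℝ) / 5), σ]}) :
    dist x x' ≤ 26 / 25 ∨ 7 / 5 ≤ dist x x' := by
  apply dr5ca_gap_of_sq dist_nonneg
  rcases hx with rfl | rfl | ⟨k, σ, hσ, rfl⟩ <;> rcases hx' with rfl | rfl | ⟨k', σ', hσ', rfl⟩
  · left; rw [dist_self]; norm_num
  · right; rw [dr5sm_poles_dist_sq]; norm_num
  · rw [dist_comm, dr5pl_ring_axis_dist_sq]
    rcases hσ' with rfl | rfl <;> norm_num
  · right; rw [dist_comm, dr5sm_poles_dist_sq]; norm_num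
  · left; rw [dist_self]; norm_num
  · rw [dist_comm, dr5pl_ring_axis_dist_sq]
    rcases hσ' with rfl | rfl <;> norm_num
  · rw [dr5pl_ring_axis_dist_sq]
    rcases hσ with rfl | rfl <;> norm_num
  · rw [dr5pl_ring_axis_dist_sq]
    rcases hσ with rfl | rfl <;> norm_num
  · rw [dr5pl_ring_dist_sq]
    exact dr5ca_ring_gap_sq k k' σ σ' hσ hσ'

end Summit.AtomisticToContinuum.Crystallization.Theorems

end
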